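import Literature.Barriers.FinalStateConjecture.KleinGordonHorizonModes
import Literature.Barriers.FinalStateConjecture.KleinGordonRealModePotential
import Literature.Analysis.ODE.LinearTransport
import Literature.Analysis.ODE.HalfLineShooting
import HarnessLib

/-!
# The real radial family at the superradiant threshold: construction, reality, normal form

Topic `Literature/Barriers/FinalStateConjecture`. First half of the shooting construction of a
REAL MODE at `ω = ω₀ = am/(2Mr₊)` (Shlapentokh-Rothman, CMP 329 (2014), §4.2, Props. 4.1–4.2,
in the ODE form of `HalfLineShooting.exists_boundState_of_sup_oscillation`): for real parameters
`π = (λ, μ)` we construct a global solution pair of the radial ODE (2.2) at `ω₀` on `(r₊, ∞)`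
agreeing near `r₊` with the explicit horizon-regular solution `P ρ` of
`KleinGordonHorizonModes.lean` (`exists_radPair`, `radPair`), show that at `ω₀` the horizon phase
is `P(r) = e^{−iω₀(r + 2M log(r − r₋))}` — smooth ACROSS `r₊` (`hzPhase_omega0`) — so that the
normalised solution `R/P(r₊)` tends to `1` at the horizon, that its real part
`u_π = Re(R/P(r₊))` is a real solution of `Δ(Δu')' = V_μ u` with the real factorised potential of
`KleinGordonRealModePotential.lean` (`radRe_hasDerivAt`), and that `v = √Δ · u` solves the normal
form `v'' = q♯ v` (`normalForm_hasDerivAt`). Everything is proved.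

## References

* Y. Shlapentokh-Rothman, Comm. Math. Phys. 329 (2014) 859–891, §2 (2.2)–(2.3), §4.1–4.2.
  Key `ShlapentokhRothman2014KleinGordon`.
-/

noncomputable section

open Set Filter Complex
open scoped Topology Real ContDiff

namespace Literature.Barriers.FinalStateConjecture

open Literature.Geometry.Lorentzian Literature.Geometry.Lorentzian.Kerr Literature.Analysis.ODE

variable {M a : ℝ} {m : ℤ}

/-! ### The threshold: `K₊ = 0`, the phase is smooth across the horizon -/

/-- At `ω₀`, `K₊ = 2Mr₊ω₀ − am = 0`. [cite: ShlapentokhRothman2014KleinGordon, Thm. 1.5] -/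
theorem hzKplus_omega0 (h : IsSubextremal M a) : hzKplus M a m (kgOmega0 M a m) = 0 := by
  have hM : M ≠ 0 := h.pos.ne'
  have hr : rPlus M a ≠ 0 := (lt_of_le_of_lt h.rMinus_nonneg h.rMinus_lt_rPlus).ne'
  have := a_mul_m_eq (m := m) hM hr
  unfold hzKplus
  have hc : ((2 * M * rPlus M a * kgOmega0 M a m : ℝ) : ℂ) = ((a * m : ℝ) : ℂ) := by rw [this]
  push_cast at hc ⊢
  linear_combination hc

/-- The smallness hypothesis of `KleinGordonHorizonModes` holds at `ω₀`. [folklore] -/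
theorem norm_hzKplus_omega0_lt (h : IsSubextremal M a) : ‖hzKplus M a m (kgOmega0 M a m)‖ < hzC M a / 8 := by
  rw [hzKplus_omega0 h, norm_zero]
  exact div_pos (hzC_pos h) (by norm_num)

/-- **The horizon phase at threshold**: `P(r) = e^{−iω₀(r + 2M log(r − r₋))}` — the coefficient
of `log(r − r₊)` in `ω₀ t̄ − m φ̄` is `(2Mr₊ω₀ − am)/(r₊ − r₋) = 0`. [cite: ShlapentokhRothman2014KleinGordon, §2 (2.3)] -/
theorem hzPhase_omega0 (h : IsSubextremal M a) (r : ℝ) :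
    hzPhase M a m (kgOmega0 M a m) r =
      Complex.exp (-(I * ((kgOmega0 M a m : ℂ) * ((r + 2 * M * Real.log (r - rMinus M a) : ℝ) : ℂ)))) := by
  have hM : M ≠ 0 := h.pos.ne'
  have hr : rPlus M a ≠ 0 := (lt_of_le_of_lt h.rMinus_nonneg h.rMinus_lt_rPlus).ne'
  have hc : rPlus M a - rMinus M a ≠ 0 := (sub_pos.2 h.rMinus_lt_rPlus).ne'
  have ham := a_mul_m_eq (m := m) hM hr
  unfold hzPhase starTime starAngle
  congr 1
  congr 1
  congr 1
  set w := kgOmega0 M a m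
  set L1 := Real.log (r - rPlus M a)
  set L2 := Real.log (r - rMinus M a)
  have key : w * (r + 2 * M * rPlus M a / (rPlus M a - rMinus M a) * L1 - 2 * M * rMinus M a / (rPlus M a - rMinus M a) * L2) -
      (m : ℝ) * (a / (rPlus M a - rMinus M a) * (L1 - L2)) = w * (r + 2 * M * L2) := by
    field_simp
    linear_combination (-(L1 - L2)) * ham
  have hc' := congrArg (fun x : ℝ ↦ (x : ℂ)) key
  push_cast at hc' ⊢
  linear_combination hc'

/-- The phase at threshold is smooth on `(r₋, ∞)` (in particular across `r₊`). [folklore] -/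
theorem contDiffOn_hzPhase_omega0 (h : IsSubextremal M a) {n : WithTop ℕ∞} :
    ContDiffOn ℝ n (hzPhase M a m (kgOmega0 M a m)) (Ioi (rMinus M a)) := by
  have hfun : hzPhase M a m (kgOmega0 M a m) = fun r ↦
      Complex.exp (-(I * ((kgOmega0 M a m : ℂ) * ((r + 2 * M * Real.log (r - rMinus M a) : ℝ) : ℂ)))) :=
    funext (hzPhase_omega0 h)
  rw [hfun]
  have hlog : ContDiffOn ℝ n (fun r : ℝ ↦ Real.log (r - rMinus M a)) (Ioi (rMinus M a)) :=
    (Real.contDiffOn_log.comp (contDiffOn_id.sub contDiffOn_const) fun r hr ↦ (sub_pos.2 hr).ne')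
  have hin : ContDiffOn ℝ n (fun r : ℝ ↦ ((r + 2 * M * Real.log (r - rMinus M a) : ℝ) : ℂ)) (Ioi (rMinus M a)) :=
    Complex.ofRealCLM.contDiff.comp_contDiffOn (contDiffOn_id.add (contDiffOn_const.mul hlog))
  exact Complex.contDiff_exp.comp_contDiffOn ((contDiffOn_const.mul (contDiffOn_const.mul hin)).neg)

/-! ### The global radial pair at threshold -/

/-- The matching radius `r₁ = r₊ + c/5`. [folklore] -/
def kgR1 (M a : ℝ) : ℝ := rPlus M a + hzC M a / 5

/-- `r₊ < r₁ < r₊ + 2c/5`. [folklore] -/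
theorem kgR1_mem (h : IsSubextremal M a) : kgR1 M a ∈ Ioo (rPlus M a) (rPlus M a + 2 * hzC M a / 5) := by
  have hc := hzC_pos h
  unfold kgR1
  constructor <;> linarith

/-- **Global solution pairs at threshold.** For real `(λ, μ)` there is a pair `(R, R')` solving the
radial ODE at `ω₀` in solved form on `(r₊, ∞)`, with the Cauchy datum of the explicit local
solution `hzRloc` at `r₁`. [cite: ShlapentokhRothman2014KleinGordon, §2 (2.2)] -/
theorem exists_radPair (h : IsSubextremal M a) (lam μ : ℝ) :
    ∃ RR : (ℝ → ℂ) × (ℝ → ℂ),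
      RR.1 (kgR1 M a) = hzRloc M a m (kgOmega0 M a m) lam μ (kgR1 M a) ∧
      RR.2 (kgR1 M a) = hzRloc' M a m (kgOmega0 M a m) lam μ (kgR1 M a) ∧
      ∀ t ∈ Ioi (rPlus M a), HasDerivAt RR.1 (RR.2 t) t ∧
        HasDerivAt RR.2 (-((((2 * t - 2 * M : ℝ)) : ℂ) / (delta M a t : ℂ)) * RR.2 t +
          kgRadialPotential M a (kgOmega0 M a m) m lam μ t / (delta M a t : ℂ) ^ 2 * RR.1 t) t := by
  obtain ⟨u, u', hu0, hu1, hsol⟩ := exists_solution_Ioi (contDiffOn_hzRadialP h (n := ∞)).continuousOn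
    (contDiffOn_hzRadialQ (w := (kgOmega0 M a m : ℂ)) (m := m) (Λ := (lam : ℂ)) (μ := μ) h (n := ∞)).continuousOn
    (kgR1 M a) (hzRloc M a m (kgOmega0 M a m) lam μ (kgR1 M a)) (hzRloc' M a m (kgOmega0 M a m) lam μ (kgR1 M a))
  exact ⟨(u, u'), hu0, hu1, hsol⟩

/-- **The radial pair** `radPair = (R, R')` at threshold (a choice). [cite: ShlapentokhRothman2014KleinGordon, §2 (2.2)] -/
def radPair (h : IsSubextremal M a) (m : ℤ) (lam μ : ℝ) : (ℝ → ℂ) × (ℝ → ℂ) := Classical.choose (exists_radPair (m := m) h lam μ)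

/-- The defining properties of `radPair`. [folklore] -/
theorem radPair_spec (h : IsSubextremal M a) (lam μ : ℝ) :
    (radPair h m lam μ).1 (kgR1 M a) = hzRloc M a m (kgOmega0 M a m) lam μ (kgR1 M a) ∧
      (radPair h m lam μ).2 (kgR1 M a) = hzRloc' M a m (kgOmega0 M a m) lam μ (kgR1 M a) ∧
      ∀ t ∈ Ioi (rPlus M a), HasDerivAt (radPair h m lam μ).1 ((radPair h m lam μ).2 t) t ∧
        HasDerivAt (radPair h m lam μ).2 (-((((2 * t - 2 * M : ℝ)) : ℂ) / (delta M a t : ℂ)) * (radPair h m lam μ).2 t +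
          kgRadialPotential M a (kgOmega0 M a m) m lam μ t / (delta M a t : ℂ) ^ 2 * (radPair h m lam μ).1 t) t :=
  Classical.choose_spec (exists_radPair (m := m) h lam μ)

attribute [irreducible] radPair

/-- **Agreement with the explicit local solution** `P ρ` on `(r₊, r₊ + 2c/5)`. [folklore] -/
theorem radPair_eqOn (h : IsSubextremal M a) (lam μ : ℝ) :
    EqOn (radPair h m lam μ).1 (hzRloc M a m (kgOmega0 M a m) lam μ) (Ioo (rPlus M a) (rPlus M a + 2 * hzC M a / 5)) ∧
      EqOn (radPair h m lam μ).2 (hzRloc' M a m (kgOmega0 M a m) lam μ) (Ioo (rPlus M a) (rPlus M a + 2 * hzC M a / 5)) := by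
  obtain ⟨h0, h1, hsol⟩ := radPair_spec (m := m) h lam μ
  have hK := norm_hzKplus_omega0_lt (m := m) h
  have hp := (contDiffOn_hzRadialP h (n := ∞)).continuousOn
  have hq := (contDiffOn_hzRadialQ (w := (kgOmega0 M a m : ℂ)) (m := m) (Λ := (lam : ℂ)) (μ := μ) h (n := ∞)).continuousOn
  have hloc : ∀ t ∈ Ioo (rPlus M a) (rPlus M a + 2 * hzC M a / 5),
      HasDerivAt (hzRloc M a m (kgOmega0 M a m) lam μ) (hzRloc' M a m (kgOmega0 M a m) lam μ t) t ∧
      HasDerivAt (hzRloc' M a m (kgOmega0 M a m) lam μ)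
        (-((((2 * t - 2 * M : ℝ)) : ℂ) / (delta M a t : ℂ)) * hzRloc' M a m (kgOmega0 M a m) lam μ t +
          kgRadialPotential M a (kgOmega0 M a m) m lam μ t / (delta M a t : ℂ) ^ 2 * hzRloc M a m (kgOmega0 M a m) lam μ t) t :=
    fun t ht ↦ ⟨hasDerivAt_hzRloc h hK ht.1 ht.2, hasDerivAt_hzRloc' h hK ht.1 ht.2⟩
  exact eqOn_of_solution_Ioo (hp.mono Ioo_subset_Ioi_self) (hq.mono Ioo_subset_Ioi_self) (kgR1_mem h)
    (fun t ht ↦ hsol t ht.1) hloc h0 h1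

/-! ### The normalised real solution `u = Re(R / P(r₊))` -/

/-- Real part of a complex-valued curve: derivative. [folklore] -/
theorem hasDerivAt_re_comp {f : ℝ → ℂ} {f' : ℂ} {x : ℝ} (hf : HasDerivAt f f' x) :
    HasDerivAt (fun t ↦ (f t).re) f'.re x := by
  have h := (Complex.reCLM.hasFDerivAt).comp_hasDerivAt x hf
  simpa [Function.comp_def] using h

/-- The normalising constant `P(r₊) ≠ 0` (phase at the horizon, at threshold). [folklore] -/
def radCst (M a : ℝ) (m : ℤ) : ℂ := hzPhase M a m (kgOmega0 M a m) (rPlus M a)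

/-- `P(r₊) ≠ 0`. [folklore] -/
theorem radCst_ne_zero : radCst M a m ≠ 0 := hzPhase_ne_zero _

/-- **The normalised real radial function** `u_π(r) = Re(R_π(r)/P(r₊))` and its derivative. [cite: ShlapentokhRothman2014KleinGordon, §4.2] -/
def radRe (h : IsSubextremal M a) (m : ℤ) (lam μ : ℝ) (r : ℝ) : ℝ := ((radPair h m lam μ).1 r / radCst M a m).re

/-- See `radRe`. [folklore] -/
def radRe' (h : IsSubextremal M a) (m : ℤ) (lam μ : ℝ) (r : ℝ) : ℝ := ((radPair h m lam μ).2 r / radCst M a m).re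

/-- The solved-form coefficients at threshold are real: `V/Δ²` is `kgVre/Δ²`. [folklore] -/
theorem radialQ_omega0_eq (h : IsSubextremal M a) (lam μ t : ℝ) :
    kgRadialPotential M a (kgOmega0 M a m) m lam μ t / (delta M a t : ℂ) ^ 2 = ((kgVre M a m lam μ t / delta M a t ^ 2 : ℝ) : ℂ) := by
  rw [kgRadialPotential_omega0 h]; push_cast; ring

/-- **`u_π` is a real solution of the radial ODE at threshold** (solved form with the real
factorised potential): `u' = u_π'`, `u_π'' = −(Δ'/Δ) u_π' + (V_μ/Δ²) u_π` on `(r₊, ∞)`. [cite: ShlapentokhRothman2014KleinGordon, §2 (2.2)] -/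
theorem radRe_hasDerivAt (h : IsSubextremal M a) (lam μ : ℝ) {t : ℝ} (ht : rPlus M a < t) :
    HasDerivAt (radRe h m lam μ) (radRe' h m lam μ t) t ∧
      HasDerivAt (radRe' h m lam μ) (-((2 * t - 2 * M) / delta M a t) * radRe' h m lam μ t +
        kgVre M a m lam μ t / delta M a t ^ 2 * radRe h m lam μ t) t := by
  obtain ⟨-, -, hsol⟩ := radPair_spec (m := m) h lam μ
  obtain ⟨h1, h2⟩ := hsol t ht
  have hc := radCst_ne_zero (M := M) (a := a) (m := m)
  have h1' := hasDerivAt_re_comp (h1.div_const (radCst M a m))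
  have h2' := hasDerivAt_re_comp (h2.div_const (radCst M a m))
  refine ⟨h1', h2'.congr_deriv ?_⟩
  rw [radialQ_omega0_eq h, add_div, radRe, radRe']
  rw [show -((((2 * t - 2 * M : ℝ)) : ℂ) / (delta M a t : ℂ)) * (radPair h m lam μ).2 t / radCst M a m =
      (((-((2 * t - 2 * M) / delta M a t)) : ℝ) : ℂ) * ((radPair h m lam μ).2 t / radCst M a m) by push_cast; ring,
    show ((kgVre M a m lam μ t / delta M a t ^ 2 : ℝ) : ℂ) * (radPair h m lam μ).1 t / radCst M a m =
      ((kgVre M a m lam μ t / delta M a t ^ 2 : ℝ) : ℂ) * ((radPair h m lam μ).1 t / radCst M a m) by ring,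
    Complex.add_re, Complex.re_ofReal_mul, Complex.re_ofReal_mul]

/-- **The flux form** `(Δ u')' = (V_μ/Δ) u` on `(r₊, ∞)` (for the maximum principle
`pos_of_flux_tendsto_zero`). [cite: ShlapentokhRothman2014KleinGordon, §3.2] -/
theorem radRe_flux_hasDerivAt (h : IsSubextremal M a) (lam μ : ℝ) {t : ℝ} (ht : rPlus M a < t) :
    HasDerivAt (fun s ↦ delta M a s * radRe' h m lam μ s) (kgVre M a m lam μ t / delta M a t * radRe h m lam μ t) t := by
  obtain ⟨-, h2⟩ := radRe_hasDerivAt (m := m) h lam μ ht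
  have hΔ : 0 < delta M a t := delta_pos_of_gt h ht
  have hΔd : HasDerivAt (delta M a) (2 * t - 2 * M) t := by
    have hid := hasDerivAt_id' t
    have h3 := ((hid.mul hid).sub (hid.const_mul (2 * M))).add_const (a ^ 2)
    have hfd : delta M a = fun x ↦ x * x - 2 * M * x + a ^ 2 := by funext x; unfold delta; ring
    rw [hfd]
    exact h3.congr_deriv (by ring)
  refine (hΔd.mul h2).congr_deriv ?_
  field_simp
  ring

/-! ### The normal form `v = √Δ u` -/

/-- `v_π = √Δ · u_π`. [folklore] -/
def radV (h : IsSubextremal M a) (m : ℤ) (lam μ : ℝ) (r : ℝ) : ℝ := Real.sqrt (delta M a r) * radRe h m lam μ r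

/-- `v_π' = Δ'/(2√Δ) · u_π + √Δ · u_π'`. [folklore] -/
def radV' (h : IsSubextremal M a) (m : ℤ) (lam μ : ℝ) (r : ℝ) : ℝ :=
  (2 * r - 2 * M) / (2 * Real.sqrt (delta M a r)) * radRe h m lam μ r + Real.sqrt (delta M a r) * radRe' h m lam μ r

/-- **The normal form**: `v' = radV'`, `radV'' = q♯ v` on `(r₊, ∞)`, `q♯ = (V_μ − (M² − a²))/Δ²`.
[cite: ShlapentokhRothman2014KleinGordon, §2 (2.2)] -/
theorem normalForm_hasDerivAt (h : IsSubextremal M a) (lam μ : ℝ) {t : ℝ} (ht : rPlus M a < t) :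
    HasDerivAt (radV h m lam μ) (radV' h m lam μ t) t ∧
      HasDerivAt (radV' h m lam μ) (kgQsharp M a m lam μ t * radV h m lam μ t) t := by
  obtain ⟨h1, h2⟩ := radRe_hasDerivAt (m := m) h lam μ ht
  have hΔ : 0 < delta M a t := delta_pos_of_gt h ht
  have hΔd : HasDerivAt (delta M a) (2 * t - 2 * M) t := by
    have hid := hasDerivAt_id' t
    have h3 := ((hid.mul hid).sub (hid.const_mul (2 * M))).add_const (a ^ 2)
    have hfd : delta M a = fun x ↦ x * x - 2 * M * x + a ^ 2 := by funext x; unfold delta; ring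
    rw [hfd]
    exact h3.congr_deriv (by ring)
  have hS : HasDerivAt (fun s ↦ Real.sqrt (delta M a s)) ((2 * t - 2 * M) / (2 * Real.sqrt (delta M a t))) t := hΔd.sqrt hΔ.ne'
  have hsq : Real.sqrt (delta M a t) ^ 2 = delta M a t := Real.sq_sqrt hΔ.le
  have hS0 : 0 < Real.sqrt (delta M a t) := Real.sqrt_pos.2 hΔ
  set S := Real.sqrt (delta M a t) with hSdef
  set D := delta M a t with hDdef
  have hD' : D = t ^ 2 - 2 * M * t + a ^ 2 := rfl
  constructor
  · have := hS.mul h1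
    unfold radV
    refine this.congr_deriv ?_
    rw [radV']
  · -- `v'' = q♯ v`
    have hlin : HasDerivAt (fun s : ℝ ↦ 2 * s - 2 * M) 2 t := by
      simpa using ((hasDerivAt_id' t).const_mul 2).sub_const (2 * M)
    have hcoef : HasDerivAt (fun s ↦ (2 * s - 2 * M) / (2 * Real.sqrt (delta M a s)))
        ((2 * (2 * S) - (2 * t - 2 * M) * (2 * ((2 * t - 2 * M) / (2 * S)))) / (2 * S) ^ 2) t :=
      hlin.div (hS.const_mul 2) (by positivity)
    have htot := (hcoef.mul h1).add (hS.mul h2)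
    unfold radV'
    refine htot.congr_deriv ?_
    rw [radV, kgQsharp, ← hSdef, ← hDdef]
    set u := radRe h m lam μ t
    set u1 := radRe' h m lam μ t
    set V := kgVre M a m lam μ t
    have hS2 : S ≠ 0 := hS0.ne'
    have hD0 : D ≠ 0 := hΔ.ne'
    field_simp
    -- reduce powers of `S` using `S² = D`
    have hS4 : S ^ 4 = D ^ 2 := by rw [show S ^ 4 = (S ^ 2) ^ 2 by ring, hsq]
    have hS3 : S ^ 3 = S * D := by rw [show S ^ 3 = S * S ^ 2 by ring, hsq]
    rw [hD'] at hsq hS4 hS3 ⊢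
    linear_combination ((u * (M ^ 2 - a ^ 2) - 2 * (t - M) * u1 * (t ^ 2 - 2 * M * t + a ^ 2)) * S ^ 2 +
      u * (t ^ 2 - 2 * M * t + a ^ 2) * (M ^ 2 - a ^ 2 + (t ^ 2 - 2 * M * t + a ^ 2))) * hsq

/-! ### Joint continuity in the parameters `(λ, μ)` and the radius -/

section Joint

variable (h : IsSubextremal M a)
include h

omit h in
/-- The parameter map `(λ, μ) ↦ hzParam(ω₀, λ, μ)` is continuous. [folklore] -/
theorem continuous_hzParam_omega0 :
    Continuous fun q : ℝ × ℝ ↦ hzParam M a m (kgOmega0 M a m : ℂ) (q.1 : ℂ) q.2 := by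
  refine continuous_pi fun i ↦ ?_
  fin_cases i
  · simp only [Fin.zero_eta, hzParam_zero]; fun_prop
  · simp only [Fin.mk_one, hzParam_one]; fun_prop
  · simp only [Fin.reduceFinMk, hzParam_two]; fun_prop
  · simp only [Fin.reduceFinMk, hzParam_three]; fun_prop
  · simp only [Fin.reduceFinMk, hzParam_four]; fun_prop
  · simp only [Fin.reduceFinMk, hzParam_five]; fun_prop

omit h in
/-- The variable map `t ↦ ξ(t)` is continuous. [folklore] -/
theorem continuous_hzXi_real : Continuous fun t : ℝ ↦ hzXi M a (t : ℂ) := by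
  unfold hzXi; fun_prop

/-- **Joint continuity of the analytic factor** `((λ, μ), t) ↦ ρ_{λ,μ}(t)` at radii in the
horizon disc. [folklore] -/
theorem continuousAt_hzRhoC_joint {x : (ℝ × ℝ) × ℝ} (hx : |x.2 - rPlus M a| < 2 * hzC M a / 5) :
    ContinuousAt (fun y : (ℝ × ℝ) × ℝ ↦ hzRhoC M a m (kgOmega0 M a m) (y.1.1 : ℂ) y.1.2 (y.2 : ℂ)) x := by
  have hK := norm_hzKplus_omega0_lt (m := m) h
  have hα := norm_hzParam_zero_lt m (kgOmega0 M a m : ℂ) (x.1.1 : ℂ) x.1.2 h hK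
  have hζ : ‖((x.2 : ℂ)) - rPlus M a‖ < 2 * hzC M a / 5 := by
    rw [show ((x.2 : ℂ)) - rPlus M a = ((x.2 - rPlus M a : ℝ) : ℂ) by push_cast; ring, Complex.norm_real, Real.norm_eq_abs]
    exact hx
  have hξ := norm_hzXi_lt h hζ
  have hF := (contDiffAt_heunFun hξ hα (n := 0) (by simp)).continuousAt
  have hin : Continuous fun y : (ℝ × ℝ) × ℝ ↦
      ((hzXi M a (y.2 : ℂ), hzParam M a m (kgOmega0 M a m : ℂ) (y.1.1 : ℂ) y.1.2) : ℂ × HP) :=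
    ((continuous_hzXi_real (M := M) (a := a)).comp continuous_snd).prodMk
      ((continuous_hzParam_omega0 (M := M) (a := a) (m := m)).comp continuous_fst)
  have hcomp := ContinuousAt.comp (f := fun y : (ℝ × ℝ) × ℝ ↦
      ((hzXi M a (y.2 : ℂ), hzParam M a m (kgOmega0 M a m : ℂ) (y.1.1 : ℂ) y.1.2) : ℂ × HP)) hF hin.continuousAt
  exact hcomp

/-- Joint continuity of `((λ, μ), t) ↦ ρ'_{λ,μ}(t)` at radii in the horizon disc. [folklore] -/
theorem continuousAt_hzRhoC'_joint {x : (ℝ × ℝ) × ℝ} (hx : |x.2 - rPlus M a| < 2 * hzC M a / 5) :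
    ContinuousAt (fun y : (ℝ × ℝ) × ℝ ↦ hzRhoC' M a m (kgOmega0 M a m) (y.1.1 : ℂ) y.1.2 (y.2 : ℂ)) x := by
  have hK := norm_hzKplus_omega0_lt (m := m) h
  have hα := norm_hzParam_zero_lt m (kgOmega0 M a m : ℂ) (x.1.1 : ℂ) x.1.2 h hK
  have hζ : ‖((x.2 : ℂ)) - rPlus M a‖ < 2 * hzC M a / 5 := by
    rw [show ((x.2 : ℂ)) - rPlus M a = ((x.2 - rPlus M a : ℝ) : ℂ) by push_cast; ring, Complex.norm_real, Real.norm_eq_abs]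
    exact hx
  have hξ := norm_hzXi_lt h hζ
  have hF := (contDiffAt_heunDer hξ hα (n := 0) (by simp)).continuousAt
  have hin : Continuous fun y : (ℝ × ℝ) × ℝ ↦
      ((hzXi M a (y.2 : ℂ), hzParam M a m (kgOmega0 M a m : ℂ) (y.1.1 : ℂ) y.1.2) : ℂ × HP) :=
    ((continuous_hzXi_real (M := M) (a := a)).comp continuous_snd).prodMk
      ((continuous_hzParam_omega0 (M := M) (a := a) (m := m)).comp continuous_fst)
  have hcomp := ContinuousAt.comp (f := fun y : (ℝ × ℝ) × ℝ ↦
      ((hzXi M a (y.2 : ℂ), hzParam M a m (kgOmega0 M a m : ℂ) (y.1.1 : ℂ) y.1.2) : ℂ × HP)) hF hin.continuousAt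
  unfold hzRhoC'
  exact hcomp.div_const _

/-- The phase at threshold, `t ↦ P(t)`, is continuous on `(r₋, ∞)`. [folklore] -/
theorem continuousAt_hzPhase_omega0 {t : ℝ} (ht : rMinus M a < t) :
    ContinuousAt (hzPhase M a m (kgOmega0 M a m)) t :=
  (contDiffOn_hzPhase_omega0 (m := m) h (n := 0)).continuousOn.continuousAt (Ioi_mem_nhds ht)

/-- **Joint continuity of the local solution** `((λ, μ), t) ↦ (P ρ)(t)` at radii in the
horizon disc `|t − r₊| < 2c/5`. [folklore] -/
theorem continuousAt_hzRloc_joint {x : (ℝ × ℝ) × ℝ} (hx : |x.2 - rPlus M a| < 2 * hzC M a / 5) :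
    ContinuousAt (fun y : (ℝ × ℝ) × ℝ ↦ hzRloc M a m (kgOmega0 M a m) (y.1.1 : ℂ) y.1.2 y.2) x := by
  have hc := hzC_pos h
  have hcdef : hzC M a = rPlus M a - rMinus M a := rfl
  have ht : rMinus M a < x.2 := by
    have := (abs_lt.1 hx).1
    linarith
  have hP : ContinuousAt (fun y : (ℝ × ℝ) × ℝ ↦ hzPhase M a m (kgOmega0 M a m) y.2) x :=
    (continuousAt_hzPhase_omega0 (m := m) h ht).comp continuous_snd.continuousAt
  unfold hzRloc
  exact hP.mul (continuousAt_hzRhoC_joint (m := m) h hx)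

/-- Joint continuity of `((λ, μ), t) ↦ (P ρ)'(t)` at radii in the horizon disc, `t ≠ r₊`
(the term `K/Δ`). [folklore] -/
theorem continuousAt_hzRloc'_joint {x : (ℝ × ℝ) × ℝ} (hx : |x.2 - rPlus M a| < 2 * hzC M a / 5) (hx' : rPlus M a < x.2) :
    ContinuousAt (fun y : (ℝ × ℝ) × ℝ ↦ hzRloc' M a m (kgOmega0 M a m) (y.1.1 : ℂ) y.1.2 y.2) x := by
  have hc := hzC_pos h
  have hcdef : hzC M a = rPlus M a - rMinus M a := rfl
  have ht : rMinus M a < x.2 := by linarith [h.rMinus_lt_rPlus]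
  have hP : ContinuousAt (fun y : (ℝ × ℝ) × ℝ ↦ hzPhase M a m (kgOmega0 M a m) y.2) x :=
    (continuousAt_hzPhase_omega0 (m := m) h ht).comp continuous_snd.continuousAt
  have hΔ : ContinuousAt (fun y : (ℝ × ℝ) × ℝ ↦ (delta M a y.2 : ℂ)) x := by
    have : Continuous fun y : (ℝ × ℝ) × ℝ ↦ (delta M a y.2 : ℂ) := by unfold delta; fun_prop
    exact this.continuousAt
  have hΔ0 : (delta M a x.2 : ℂ) ≠ 0 := by exact_mod_cast (delta_pos_of_gt h hx').ne'
  have hKc : ContinuousAt (fun y : (ℝ × ℝ) × ℝ ↦ hzK a m (kgOmega0 M a m : ℂ) y.2) x := by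
    have : Continuous fun y : (ℝ × ℝ) × ℝ ↦ hzK a m (kgOmega0 M a m : ℂ) y.2 := by unfold hzK; fun_prop
    exact this.continuousAt
  unfold hzRloc'
  exact hP.mul ((continuousAt_hzRhoC'_joint (m := m) h hx).sub
    ((continuousAt_const.mul (hKc.div hΔ hΔ0)).mul (continuousAt_hzRhoC_joint (m := m) h hx)))

/-- The solved-form coefficient `p = −Δ'/Δ` as a (parameter-independent) family, smooth jointly. [folklore] -/
theorem contDiffOn_pcf_joint {n : WithTop ℕ∞} :
    ContDiffOn ℝ n (fun x : (ℝ × ℝ) × ℝ ↦ -((((2 * x.2 - 2 * M : ℝ)) : ℂ) / (delta M a x.2 : ℂ))) (univ ×ˢ Ioi (rPlus M a)) :=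
  (contDiffOn_hzRadialP h (n := n)).comp contDiff_snd.contDiffOn fun _ hx ↦ hx.2

omit h in
/-- The radial potential is smooth jointly in `(λ, μ, r)` (polynomial). [folklore] -/
theorem contDiff_kgRadialPotential_joint {n : WithTop ℕ∞} :
    ContDiff ℝ n (fun x : (ℝ × ℝ) × ℝ ↦ kgRadialPotential M a (kgOmega0 M a m : ℂ) m (x.1.1 : ℂ) x.1.2 x.2) := by
  unfold kgRadialPotential
  have cs : ContDiff ℝ n fun x : (ℝ × ℝ) × ℝ ↦ x.2 := contDiff_snd
  have cl : ContDiff ℝ n fun x : (ℝ × ℝ) × ℝ ↦ x.1.1 := contDiff_fst.comp contDiff_fst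
  have cm : ContDiff ℝ n fun x : (ℝ × ℝ) × ℝ ↦ x.1.2 := contDiff_snd.comp contDiff_fst
  have oR : ContDiff ℝ n fun t : ℝ ↦ (t : ℂ) := Complex.ofRealCLM.contDiff
  have c1 : ContDiff ℝ n (fun x : (ℝ × ℝ) × ℝ ↦ (((x.2 ^ 2 + a ^ 2) ^ 2 : ℝ) : ℂ)) :=
    oR.comp (((cs.pow 2).add contDiff_const).pow 2)
  have c2 : ContDiff ℝ n (fun x : (ℝ × ℝ) × ℝ ↦ (((4 * M * a * m * x.2 : ℝ)) : ℂ)) := oR.comp (contDiff_const.mul cs)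
  have c3 : ContDiff ℝ n (fun x : (ℝ × ℝ) × ℝ ↦ (delta M a x.2 : ℂ)) := by
    have hd : delta M a = fun t ↦ t ^ 2 - 2 * M * t + a ^ 2 := funext fun t ↦ rfl
    rw [hd]
    exact oR.comp (((cs.pow 2).sub (contDiff_const.mul cs)).add contDiff_const)
  have c4 : ContDiff ℝ n (fun x : (ℝ × ℝ) × ℝ ↦ (((x.1.2 ^ 2 * x.2 ^ 2 : ℝ)) : ℂ)) := oR.comp ((cm.pow 2).mul (cs.pow 2))
  have c5 : ContDiff ℝ n (fun x : (ℝ × ℝ) × ℝ ↦ ((x.1.1 : ℝ) : ℂ)) := oR.comp cl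
  exact (((c1.neg.mul contDiff_const).add (c2.mul contDiff_const)).sub contDiff_const).add
    (c3.mul ((c5.add contDiff_const).add c4))

/-- The solved-form coefficient `q = V/Δ²` as a family, smooth jointly on `ℝ² × (r₊, ∞)`. [folklore] -/
theorem contDiffOn_qcf_joint {n : WithTop ℕ∞} :
    ContDiffOn ℝ n (fun x : (ℝ × ℝ) × ℝ ↦
      kgRadialPotential M a (kgOmega0 M a m : ℂ) m (x.1.1 : ℂ) x.1.2 x.2 / (delta M a x.2 : ℂ) ^ 2) (univ ×ˢ Ioi (rPlus M a)) := by
  have hΔ : ∀ x ∈ (univ ×ˢ Ioi (rPlus M a) : Set ((ℝ × ℝ) × ℝ)), (delta M a x.2 : ℂ) ^ 2 ≠ 0 := fun _ hx ↦ by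
    refine pow_ne_zero 2 ?_
    exact_mod_cast (delta_pos_of_gt h hx.2).ne'
  have h2 : ContDiff ℝ n (fun x : (ℝ × ℝ) × ℝ ↦ (delta M a x.2 : ℂ) ^ 2) := by
    have hd : delta M a = fun t ↦ t ^ 2 - 2 * M * t + a ^ 2 := funext fun t ↦ rfl
    rw [hd]
    exact (Complex.ofRealCLM.contDiff.comp (((contDiff_snd.pow 2).sub (contDiff_const.mul contDiff_snd)).add contDiff_const)).pow 2
  have h3 : ContDiffOn ℝ n (fun x : (ℝ × ℝ) × ℝ ↦ kgRadialPotential M a (kgOmega0 M a m : ℂ) m (x.1.1 : ℂ) x.1.2 x.2 *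
      ((delta M a x.2 : ℂ) ^ 2)⁻¹) (univ ×ˢ Ioi (rPlus M a)) :=
    (contDiff_kgRadialPotential_joint (m := m)).contDiffOn.mul (h2.contDiffOn.inv hΔ)
  exact h3.congr fun x _ ↦ by rw [div_eq_mul_inv]

/-- **Joint continuity of the global radial pair** `((λ, μ), t) ↦ (R_{λ,μ}(t), R'_{λ,μ}(t))` at
every `t > r₊` (near the horizon by the explicit series; beyond by transport,
`Literature.Analysis.ODE.exists_transport_joint`). [cite: ShlapentokhRothman2014KleinGordon, App. A] -/
theorem continuousAt_radPair_joint {x : (ℝ × ℝ) × ℝ} (hx : rPlus M a < x.2) :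
    ContinuousAt (fun y : (ℝ × ℝ) × ℝ ↦ (radPair h m y.1.1 y.1.2).1 y.2) x ∧
      ContinuousAt (fun y : (ℝ × ℝ) × ℝ ↦ (radPair h m y.1.1 y.1.2).2 y.2) x := by
  have hc := hzC_pos h
  rcases lt_or_ge x.2 (rPlus M a + 2 * hzC M a / 5) with hlow | hhigh
  · -- inside the horizon disc: the explicit local solution
    have habs : |x.2 - rPlus M a| < 2 * hzC M a / 5 := by rw [abs_lt]; constructor <;> linarith
    have hO : (univ ×ˢ Ioo (rPlus M a) (rPlus M a + 2 * hzC M a / 5) : Set ((ℝ × ℝ) × ℝ)) ∈ 𝓝 x :=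
      (isOpen_univ.prod isOpen_Ioo).mem_nhds ⟨trivial, hx, hlow⟩
    have he1 : (fun y : (ℝ × ℝ) × ℝ ↦ (radPair h m y.1.1 y.1.2).1 y.2) =ᶠ[𝓝 x]
        fun y ↦ hzRloc M a m (kgOmega0 M a m) (y.1.1 : ℂ) y.1.2 y.2 :=
      Filter.eventuallyEq_of_mem hO fun y hy ↦ (radPair_eqOn (m := m) h y.1.1 y.1.2).1 hy.2
    have he2 : (fun y : (ℝ × ℝ) × ℝ ↦ (radPair h m y.1.1 y.1.2).2 y.2) =ᶠ[𝓝 x]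
        fun y ↦ hzRloc' M a m (kgOmega0 M a m) (y.1.1 : ℂ) y.1.2 y.2 :=
      Filter.eventuallyEq_of_mem hO fun y hy ↦ (radPair_eqOn (m := m) h y.1.1 y.1.2).2 hy.2
    exact ⟨(continuousAt_hzRloc_joint (m := m) h habs).congr_of_eventuallyEq he1,
      (continuousAt_hzRloc'_joint (m := m) h habs hx).congr_of_eventuallyEq he2⟩
  · -- beyond: transport from `r₁`
    have hr₁ := kgR1_mem h
    set r₁ := kgR1 M a with hr₁def
    set r₂ := x.2 + 1 with hr₂
    have h12 : r₁ < r₂ := by rw [hr₂]; linarith [hr₁.2]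
    obtain ⟨Ψ, ε, hε, hΨ, htr⟩ := exists_transport_joint (P := ℝ × ℝ) (n := 1) le_rfl isOpen_univ hr₁.1 h12
      (pc := fun (_ : ℝ × ℝ) (t : ℝ) ↦ -((((2 * t - 2 * M : ℝ)) : ℂ) / (delta M a t : ℂ)))
      (qc := fun (q : ℝ × ℝ) (t : ℝ) ↦ kgRadialPotential M a (kgOmega0 M a m : ℂ) m (q.1 : ℂ) q.2 t / (delta M a t : ℂ) ^ 2)
      (contDiffOn_pcf_joint h) (contDiffOn_qcf_joint (m := m) h)
    -- the data at `r₁` are continuous in the parameters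
    have hd1 : Continuous fun q : ℝ × ℝ ↦ (radPair h m q.1 q.2).1 r₁ := by
      have habs : |r₁ - rPlus M a| < 2 * hzC M a / 5 := by rw [abs_lt]; constructor <;> linarith [hr₁.1, hr₁.2]
      rw [continuous_iff_continuousAt]
      intro q
      have hA := continuousAt_hzRloc_joint (m := m) h (x := (q, r₁)) habs
      have hB : ContinuousAt (fun q' : ℝ × ℝ ↦ ((q', r₁) : (ℝ × ℝ) × ℝ)) q := (continuous_id.prodMk continuous_const).continuousAt
      have hcomp := ContinuousAt.comp (f := fun q' : ℝ × ℝ ↦ ((q', r₁) : (ℝ × ℝ) × ℝ)) hA hB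
      exact hcomp.congr (Eventually.of_forall fun q' ↦ ((radPair_spec (m := m) h q'.1 q'.2).1).symm)
    have hd2 : Continuous fun q : ℝ × ℝ ↦ (radPair h m q.1 q.2).2 r₁ := by
      have habs : |r₁ - rPlus M a| < 2 * hzC M a / 5 := by rw [abs_lt]; constructor <;> linarith [hr₁.1, hr₁.2]
      rw [continuous_iff_continuousAt]
      intro q
      have hA := continuousAt_hzRloc'_joint (m := m) h (x := (q, r₁)) habs hr₁.1
      have hB : ContinuousAt (fun q' : ℝ × ℝ ↦ ((q', r₁) : (ℝ × ℝ) × ℝ)) q := (continuous_id.prodMk continuous_const).continuousAt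
      have hcomp := ContinuousAt.comp (f := fun q' : ℝ × ℝ ↦ ((q', r₁) : (ℝ × ℝ) × ℝ)) hA hB
      exact hcomp.congr (Eventually.of_forall fun q' ↦ ((radPair_spec (m := m) h q'.1 q'.2).2.1).symm)
    -- the transported expression is jointly continuous near `x`
    have hxI : x.2 ∈ Ioo (r₁ - ε) (r₂ + ε) := by
      constructor
      · have : r₁ ≤ x.2 := by rw [hr₁def]; unfold kgR1; linarith
        linarith
      · rw [hr₂]; linarith
    have hO : (univ ×ˢ Ioo (r₁ - ε) (r₂ + ε) : Set ((ℝ × ℝ) × ℝ)) ∈ 𝓝 x :=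
      (isOpen_univ.prod isOpen_Ioo).mem_nhds ⟨trivial, hxI⟩
    have hΨc : ContinuousOn (fun z : (ℝ × ℝ) × ℝ × W2 ↦ Ψ z.1 z.2.1 z.2.2) (univ ×ˢ (Ioo (r₁ - ε) (r₂ + ε) ×ˢ univ)) :=
      hΨ.continuousOn
    have hG : ContinuousAt (fun y : (ℝ × ℝ) × ℝ ↦ Ψ y.1 y.2 ((radPair h m y.1.1 y.1.2).1 r₁, (radPair h m y.1.1 y.1.2).2 r₁)) x := by
      have hin : Continuous fun y : (ℝ × ℝ) × ℝ ↦
          ((y.1, (y.2, ((radPair h m y.1.1 y.1.2).1 r₁, (radPair h m y.1.1 y.1.2).2 r₁))) : (ℝ × ℝ) × ℝ × W2) :=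
        continuous_fst.prodMk (continuous_snd.prodMk ((hd1.comp continuous_fst).prodMk (hd2.comp continuous_fst)))
      have hmem : ((x.1, (x.2, ((radPair h m x.1.1 x.1.2).1 r₁, (radPair h m x.1.1 x.1.2).2 r₁))) : (ℝ × ℝ) × ℝ × W2) ∈
          (univ ×ˢ (Ioo (r₁ - ε) (r₂ + ε) ×ˢ univ) : Set ((ℝ × ℝ) × ℝ × W2)) := ⟨trivial, hxI, trivial⟩
      have hOz : (univ ×ˢ (Ioo (r₁ - ε) (r₂ + ε) ×ˢ univ) : Set ((ℝ × ℝ) × ℝ × W2)) ∈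
          𝓝 ((x.1, (x.2, ((radPair h m x.1.1 x.1.2).1 r₁, (radPair h m x.1.1 x.1.2).2 r₁))) : (ℝ × ℝ) × ℝ × W2) :=
        (isOpen_univ.prod (isOpen_Ioo.prod isOpen_univ)).mem_nhds hmem
      exact ContinuousAt.comp (f := fun y : (ℝ × ℝ) × ℝ ↦
          ((y.1, (y.2, ((radPair h m y.1.1 y.1.2).1 r₁, (radPair h m y.1.1 y.1.2).2 r₁))) : (ℝ × ℝ) × ℝ × W2))
        (hΨc.continuousAt hOz) hin.continuousAt
    -- and it agrees with the radial pair near `x`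
    have heq : ∀ y ∈ (univ ×ˢ Ioo (r₁ - ε) (r₂ + ε) : Set ((ℝ × ℝ) × ℝ)),
        (((radPair h m y.1.1 y.1.2).1 y.2, (radPair h m y.1.1 y.1.2).2 y.2) : W2) =
          Ψ y.1 y.2 ((radPair h m y.1.1 y.1.2).1 r₁, (radPair h m y.1.1 y.1.2).2 r₁) := fun y hy ↦
      htr y.1 (mem_univ _) _ _ (radPair_spec (m := m) h y.1.1 y.1.2).2.2 y.2 hy.2
    have he1 : (fun y : (ℝ × ℝ) × ℝ ↦ (radPair h m y.1.1 y.1.2).1 y.2) =ᶠ[𝓝 x]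
        fun y ↦ (Ψ y.1 y.2 ((radPair h m y.1.1 y.1.2).1 r₁, (radPair h m y.1.1 y.1.2).2 r₁)).1 :=
      Filter.eventuallyEq_of_mem hO fun y hy ↦ by rw [← heq y hy]
    have he2 : (fun y : (ℝ × ℝ) × ℝ ↦ (radPair h m y.1.1 y.1.2).2 y.2) =ᶠ[𝓝 x]
        fun y ↦ (Ψ y.1 y.2 ((radPair h m y.1.1 y.1.2).1 r₁, (radPair h m y.1.1 y.1.2).2 r₁)).2 :=
      Filter.eventuallyEq_of_mem hO fun y hy ↦ by rw [← heq y hy]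
    exact ⟨(continuousAt_fst.comp hG).congr_of_eventuallyEq he1, (continuousAt_snd.comp hG).congr_of_eventuallyEq he2⟩

/-- **Joint continuity on `ℝ² × (r₊, ∞)`** of the radial pair. [folklore] -/
theorem continuousOn_radPair_joint :
    ContinuousOn (fun y : (ℝ × ℝ) × ℝ ↦ (radPair h m y.1.1 y.1.2).1 y.2) (univ ×ˢ Ioi (rPlus M a)) ∧
      ContinuousOn (fun y : (ℝ × ℝ) × ℝ ↦ (radPair h m y.1.1 y.1.2).2 y.2) (univ ×ˢ Ioi (rPlus M a)) :=
  ⟨fun _ hx ↦ (continuousAt_radPair_joint (m := m) h hx.2).1.continuousWithinAt,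
    fun _ hx ↦ (continuousAt_radPair_joint (m := m) h hx.2).2.continuousWithinAt⟩

end Joint

/-! ### The one-parameter family in the mass `μ` (with a continuous eigenvalue function `λ(μ)`) -/

section Family

variable (h : IsSubextremal M a) (lamf : ℝ → ℝ)
include h

/-- The normal-form family `v(μ, t) = √Δ · u_{λ(μ), μ}(t)`. [folklore] -/
def famV (h : IsSubextremal M a) (m : ℤ) (lamf : ℝ → ℝ) (μ t : ℝ) : ℝ := radV h m (lamf μ) μ t

/-- Its `t`-derivative family. [folklore] -/
def famV' (h : IsSubextremal M a) (m : ℤ) (lamf : ℝ → ℝ) (μ t : ℝ) : ℝ := radV' h m (lamf μ) μ t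

/-- The coefficient family `Q(μ, t) = q♯_{λ(μ), μ}(t)`. [folklore] -/
def famQ (M a : ℝ) (m : ℤ) (lamf : ℝ → ℝ) (μ t : ℝ) : ℝ := kgQsharp M a m (lamf μ) μ t

/-- `Q(μ, ·)` is continuous on `(r₊, ∞)`. [folklore] -/
theorem famQ_continuousOn (μ : ℝ) : ContinuousOn (famQ M a m lamf μ) (Ioi (rPlus M a)) := by
  have hΔ : ∀ t ∈ Ioi (rPlus M a), delta M a t ^ 2 ≠ 0 := fun t ht ↦ pow_ne_zero 2 (delta_pos_of_gt h ht).ne'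
  have hc : Continuous fun t : ℝ ↦ kgVre M a m (lamf μ) μ t - (M ^ 2 - a ^ 2) := by
    unfold kgVre delta; fun_prop
  have hd : Continuous fun t : ℝ ↦ delta M a t ^ 2 := by unfold delta; fun_prop
  unfold famQ kgQsharp
  exact hc.continuousOn.div hd.continuousOn hΔ

/-- The family solves `v'' = Q v` on `(r₊, ∞)`. [folklore] -/
theorem fam_hsol (μ : ℝ) {t : ℝ} (ht : t ∈ Ioi (rPlus M a)) :
    HasDerivAt (famV h m lamf μ) (famV' h m lamf μ t) t ∧
      HasDerivAt (famV' h m lamf μ) (famQ M a m lamf μ t * famV h m lamf μ t) t :=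
  normalForm_hasDerivAt (m := m) h (lamf μ) μ ht

/-- Joint continuity of `(μ, t) ↦ (u_{λ(μ),μ}(t), u'_{λ(μ),μ}(t))` on `[μa, μb] × (r₊, ∞)`. [folklore] -/
theorem radRe_family_joint {μa μb : ℝ} (hcont : ContinuousOn lamf (Icc μa μb)) :
    ContinuousOn (fun p : ℝ × ℝ ↦ radRe h m (lamf p.1) p.1 p.2) (Icc μa μb ×ˢ Ioi (rPlus M a)) ∧
      ContinuousOn (fun p : ℝ × ℝ ↦ radRe' h m (lamf p.1) p.1 p.2) (Icc μa μb ×ˢ Ioi (rPlus M a)) := by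
  obtain ⟨hR1, hR2⟩ := continuousOn_radPair_joint (m := m) h
  -- the parameter embedding `(μ, t) ↦ ((λ(μ), μ), t)`
  have hemb : ContinuousOn (fun p : ℝ × ℝ ↦ (((lamf p.1, p.1), p.2) : (ℝ × ℝ) × ℝ)) (Icc μa μb ×ˢ Ioi (rPlus M a)) := by
    have h1 : ContinuousOn (fun p : ℝ × ℝ ↦ lamf p.1) (Icc μa μb ×ˢ Ioi (rPlus M a)) :=
      hcont.comp continuous_fst.continuousOn fun p hp ↦ hp.1
    exact (h1.prodMk continuous_fst.continuousOn).prodMk continuous_snd.continuousOn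
  have hmaps : MapsTo (fun p : ℝ × ℝ ↦ (((lamf p.1, p.1), p.2) : (ℝ × ℝ) × ℝ)) (Icc μa μb ×ˢ Ioi (rPlus M a))
      (univ ×ˢ Ioi (rPlus M a)) := fun p hp ↦ ⟨trivial, hp.2⟩
  have hu : ContinuousOn (fun p : ℝ × ℝ ↦ (radPair h m (lamf p.1) p.1).1 p.2) (Icc μa μb ×ˢ Ioi (rPlus M a)) :=
    hR1.comp hemb hmaps
  have hu' : ContinuousOn (fun p : ℝ × ℝ ↦ (radPair h m (lamf p.1) p.1).2 p.2) (Icc μa μb ×ˢ Ioi (rPlus M a)) :=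
    hR2.comp hemb hmaps
  refine ⟨?_, ?_⟩
  · have := Complex.continuous_re.comp_continuousOn (hu.div_const (radCst M a m))
    exact this
  · have := Complex.continuous_re.comp_continuousOn (hu'.div_const (radCst M a m))
    exact this

/-- **Joint continuity of the family in `(μ, t)`** on `[μa, μb] × (r₊, ∞)` for a continuous
eigenvalue function `λ`. [folklore] -/
theorem fam_joint {μa μb : ℝ} (hcont : ContinuousOn lamf (Icc μa μb)) :
    ContinuousOn (fun p : ℝ × ℝ ↦ famV h m lamf p.1 p.2) (Icc μa μb ×ˢ Ioi (rPlus M a)) ∧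
      ContinuousOn (fun p : ℝ × ℝ ↦ famV' h m lamf p.1 p.2) (Icc μa μb ×ˢ Ioi (rPlus M a)) := by
  obtain ⟨hre, hre'⟩ := radRe_family_joint (m := m) h lamf hcont
  have hsq : Continuous fun p : ℝ × ℝ ↦ Real.sqrt (delta M a p.2) := by unfold delta; fun_prop
  have hlin : Continuous fun p : ℝ × ℝ ↦ (2 * p.2 - 2 * M) := by fun_prop
  have hsq0 : ∀ p ∈ (Icc μa μb ×ˢ Ioi (rPlus M a) : Set (ℝ × ℝ)), 2 * Real.sqrt (delta M a p.2) ≠ 0 := fun p hp ↦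
    mul_ne_zero two_ne_zero (Real.sqrt_pos.2 (delta_pos_of_gt h hp.2)).ne'
  refine ⟨?_, ?_⟩
  · have := hsq.continuousOn.mul hre
    exact this
  · have := ((hlin.continuousOn.div (continuous_const.mul hsq).continuousOn hsq0).mul hre).add (hsq.continuousOn.mul hre')
    exact this

/-! ### Uniform positivity near the horizon -/

/-- The comparison function `G((λ, μ), t) = Re(P(t)/P(r₊) · ρ_{λ,μ}(t))`, continuous across `t = r₊`. [folklore] -/
def horizonG (M a : ℝ) (m : ℤ) (y : (ℝ × ℝ) × ℝ) : ℝ :=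
  (hzPhase M a m (kgOmega0 M a m) y.2 / radCst M a m * hzRhoC M a m (kgOmega0 M a m) (y.1.1 : ℂ) y.1.2 (y.2 : ℂ)).re

omit h in
/-- `G = 1` on the horizon. [folklore] -/
theorem horizonG_rPlus (q : ℝ × ℝ) : horizonG M a m (q, rPlus M a) = 1 := by
  simp only [horizonG, radCst, div_self (hzPhase_ne_zero (M := M) (a := a) (m := m) (w := (kgOmega0 M a m : ℂ)) (rPlus M a)),
    one_mul, hzRhoC, hzXi, sub_self, zero_div, heunFun_zero, Complex.one_re]

/-- `G` is continuous on the open slab `ℝ² × (r₊ − c/5, r₊ + 2c/5)`. [folklore] -/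
theorem continuousOn_horizonG :
    ContinuousOn (horizonG M a m) (univ ×ˢ Ioo (rPlus M a - hzC M a / 5) (rPlus M a + 2 * hzC M a / 5)) := by
  intro y hy
  have hc := hzC_pos h
  have hcdef : hzC M a = rPlus M a - rMinus M a := rfl
  have habs : |y.2 - rPlus M a| < 2 * hzC M a / 5 := by rw [abs_lt]; constructor <;> linarith [hy.2.1, hy.2.2]
  have ht : rMinus M a < y.2 := by linarith [hy.2.1]
  have hP : ContinuousAt (fun z : (ℝ × ℝ) × ℝ ↦ hzPhase M a m (kgOmega0 M a m) z.2) y :=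
    (continuousAt_hzPhase_omega0 (m := m) h ht).comp continuous_snd.continuousAt
  have hρ := continuousAt_hzRhoC_joint (m := m) h habs
  unfold horizonG
  exact (Complex.continuous_re.continuousAt.comp ((hP.div_const _).mul hρ)).continuousWithinAt

/-- Near the horizon `u_{λ,μ}(t) = G((λ, μ), t)` (`t ∈ (r₊, r₊ + 2c/5)`). [folklore] -/
theorem radRe_eq_horizonG (lam μ : ℝ) {t : ℝ} (ht : t ∈ Ioo (rPlus M a) (rPlus M a + 2 * hzC M a / 5)) :
    radRe h m lam μ t = horizonG M a m ((lam, μ), t) := by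
  rw [radRe, (radPair_eqOn (m := m) h lam μ).1 ht, hzRloc, horizonG]
  congr 1
  ring

/-- **Uniform positivity near the horizon**: for a compact set `K` of parameters there is
`δ > 0` with `u_{λ,μ}(t) > 1/2` for `(λ, μ) ∈ K`, `t ∈ (r₊, r₊ + δ]` (generalized tube lemma around
`K × {r₊}`, where `G = 1`). [folklore] -/
theorem exists_uniform_pos {K : Set (ℝ × ℝ)} (hK : IsCompact K) :
    ∃ δ > (0 : ℝ), rPlus M a + δ < rPlus M a + 2 * hzC M a / 5 ∧
      ∀ q ∈ K, ∀ t ∈ Ioc (rPlus M a) (rPlus M a + δ), 1 / 2 < radRe h m q.1 q.2 t := by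
  have hc := hzC_pos h
  set O : Set ((ℝ × ℝ) × ℝ) := univ ×ˢ Ioo (rPlus M a - hzC M a / 5) (rPlus M a + 2 * hzC M a / 5) with hO
  have hOopen : IsOpen O := isOpen_univ.prod isOpen_Ioo
  set N : Set ((ℝ × ℝ) × ℝ) := O ∩ horizonG M a m ⁻¹' Ioi (1 / 2) with hN
  have hNopen : IsOpen N := (continuousOn_horizonG (m := m) h).isOpen_inter_preimage hOopen isOpen_Ioi
  have hsub : K ×ˢ ({rPlus M a} : Set ℝ) ⊆ N := by
    rintro ⟨q, t⟩ ⟨hq, ht⟩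
    rw [mem_singleton_iff] at ht
    subst ht
    refine ⟨⟨trivial, by constructor <;> linarith⟩, ?_⟩
    show 1 / 2 < horizonG M a m (q, rPlus M a)
    rw [horizonG_rPlus]; norm_num
  obtain ⟨u, v, hu, hv, hKu, hrv, huv⟩ := generalized_tube_lemma hK isCompact_singleton hNopen hsub
  have hrv' : rPlus M a ∈ v := hrv (mem_singleton _)
  obtain ⟨ε, hε, hball⟩ := Metric.isOpen_iff.1 hv (rPlus M a) hrv'
  refine ⟨min (ε / 2) (hzC M a / 5), by positivity, ?_, fun q hq t ht ↦ ?_⟩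
  · have : min (ε / 2) (hzC M a / 5) ≤ hzC M a / 5 := min_le_right _ _
    linarith
  · have htv : t ∈ v := hball (by
      rw [Metric.mem_ball, Real.dist_eq, abs_lt]
      constructor <;> linarith [ht.1, ht.2, min_le_left (ε / 2) (hzC M a / 5)])
    have hmem : ((q, t) : (ℝ × ℝ) × ℝ) ∈ N := huv ⟨hKu hq, htv⟩
    have hG : 1 / 2 < horizonG M a m (q, t) := hmem.2
    have htI : t ∈ Ioo (rPlus M a) (rPlus M a + 2 * hzC M a / 5) :=
      ⟨ht.1, lt_of_le_of_lt ht.2 (by linarith [min_le_right (ε / 2) (hzC M a / 5)])⟩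
    rwa [radRe_eq_horizonG (m := m) h q.1 q.2 htI]

/-! ### The uniform tail bound `Q ≥ c > 0` beyond `S` -/

omit h in
/-- The tail radius `S(μa)` beyond which `q♯ ≥ (μa² − ω₀²)/2` uniformly. [folklore] -/
def kgTailS (M a : ℝ) (m : ℤ) (μa : ℝ) : ℝ :=
  max (max (20 * (rPlus M a + M)) 1)
    (max (20 * M * kgOmega0 M a m ^ 2 / (μa ^ 2 - kgOmega0 M a m ^ 2)) (8 * M ^ 2 / (μa ^ 2 - kgOmega0 M a m ^ 2)))

/-- **Uniform positivity of the tail**: for `0 < μa ≤ μ ≤ μb` with `ω₀² < μa²` and `λ̃(λ(μ)) ≥ 0`,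
`Q(μ, t) ≥ (μa² − ω₀²)/2` for `t ≥ S(μa)`. [cite: ShlapentokhRothman2014KleinGordon, §4.2] -/
theorem famQ_tail {μa μb : ℝ} (hμa0 : 0 < μa) (hγ : kgOmega0 M a m ^ 2 < μa ^ 2)
    (hL0 : ∀ μ ∈ Icc μa μb, 0 ≤ kgLamTilde M a m (lamf μ)) :
    ∀ μ ∈ Icc μa μb, ∀ t ∈ Ici (kgTailS M a m μa), (μa ^ 2 - kgOmega0 M a m ^ 2) / 2 ≤ famQ M a m lamf μ t := by
  intro μ hμ t ht
  have hM := h.pos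
  set w2 := kgOmega0 M a m ^ 2 with hw2
  set γ2 := μa ^ 2 - w2 with hγ2
  have hγ2 : 0 < γ2 := by rw [hγ2]; linarith
  have hw2n : 0 ≤ w2 := sq_nonneg _
  rw [mem_Ici, kgTailS] at ht
  have h1 : 20 * (rPlus M a + M) ≤ t := le_trans (le_max_left _ _) (le_trans (le_max_left _ _) ht)
  have h2 : (1 : ℝ) ≤ t := le_trans (le_max_right _ _) (le_trans (le_max_left _ _) ht)
  have h3 : 20 * M * w2 / γ2 ≤ t := le_trans (le_max_left _ _) (le_trans (le_max_right _ _) ht)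
  have h4 : 8 * M ^ 2 / γ2 ≤ t := le_trans (le_max_right _ _) (le_trans (le_max_right _ _) ht)
  have ht0 : 0 < t := by linarith
  have hlow := kgQsharp_lower (m := m) h (lam := lamf μ) (μ := μ) (hL0 μ hμ) h1
  have hμ2 : μa ^ 2 ≤ μ ^ 2 := by
    have := hμ.1
    nlinarith
  -- `5 M w2 / t ≤ γ2/4`
  have e1 : 5 * M * w2 / t ≤ γ2 / 4 := by
    rw [div_le_iff₀ ht0]
    have : 20 * M * w2 ≤ γ2 * t := by
      have := (div_le_iff₀ hγ2).1 h3
      linarith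
    linarith
  -- `2 M² / t⁴ ≤ 2 M² / t ≤ γ2/4`
  have e2 : 2 * M ^ 2 / t ^ 4 ≤ γ2 / 4 := by
    have ht4 : t ≤ t ^ 4 := by
      have : (1 : ℝ) ≤ t ^ 3 := one_le_pow₀ h2
      nlinarith
    calc 2 * M ^ 2 / t ^ 4 ≤ 2 * M ^ 2 / t := div_le_div_of_nonneg_left (by positivity) ht0 ht4
      _ ≤ γ2 / 4 := by
          rw [div_le_iff₀ ht0]
          have : 8 * M ^ 2 ≤ γ2 * t := by
            have := (div_le_iff₀ hγ2).1 h4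
            linarith
          linarith
  unfold famQ
  linarith [hlow, hμ2, e1, e2]

/-! ### An oscillation at `μa` (Sturm window in the attractive Coulomb tail) -/

omit h in
/-- The window radius `A(Lmax)`. [folklore] -/
def kgWindowA (M a : ℝ) (m : ℤ) (Lmax : ℝ) : ℝ :=
  max (20 * (rPlus M a + M)) (max (8 * Lmax / (M * kgOmega0 M a m ^ 2)) (51 / (M * kgOmega0 M a m ^ 2)))

/-- **A zero at `μa`**: if `ω₀ ≠ 0`, `λ̃(λ(μa)) ≤ Lmax`, `μa² ≤ (11/10)ω₀²` and
`μa² − ω₀² ≤ Mω₀²/(5A)`, `A = A(Lmax)`, then `v(μa, ·)` vanishes somewhere on `(r₊, ∞)`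
(Sturm window `[A, 2A]`, where `q♯ ≤ −Mω₀²/(5A)` and `Mω₀²A/5 > 10`).
[cite: ShlapentokhRothman2014KleinGordon, §4.2 Prop. 4.1] -/
theorem fam_zero_at_mua (hw0 : kgOmega0 M a m ≠ 0) {μa Lmax : ℝ}
    (hLa : kgLamTilde M a m (lamf μa) ≤ Lmax)
    (hμa1 : μa ^ 2 ≤ 11 / 10 * kgOmega0 M a m ^ 2)
    (hμa2 : μa ^ 2 - kgOmega0 M a m ^ 2 ≤ M * kgOmega0 M a m ^ 2 / (5 * kgWindowA M a m Lmax)) :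
    ∃ t ∈ Ioi (rPlus M a), famV h m lamf μa t = 0 := by
  have hM := h.pos
  set w2 := kgOmega0 M a m ^ 2 with hw2
  have hw2p : 0 < w2 := by positivity
  have hMw : 0 < M * w2 := mul_pos hM hw2p
  set A := kgWindowA M a m Lmax with hA
  have hA1 : 20 * (rPlus M a + M) ≤ A := le_max_left _ _
  have hA2 : 8 * Lmax / (M * w2) ≤ A := le_trans (le_max_left _ _) (le_max_right _ _)
  have hA3 : 51 / (M * w2) ≤ A := le_trans (le_max_right _ _) (le_max_right _ _)
  have hrp : 0 ≤ rPlus M a := le_trans h.rMinus_nonneg h.rMinus_lt_rPlus.le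
  have hA0 : 0 < A := by nlinarith
  have hAr : rPlus M a < A := by nlinarith
  set k : ℝ := Real.sqrt (M * w2 / (5 * A)) with hk
  have hk2 : k ^ 2 = M * w2 / (5 * A) := Real.sq_sqrt (by positivity)
  -- the coefficient bound on the window
  have hqk : ∀ t ∈ Icc A (2 * A), famQ M a m lamf μa t ≤ -k ^ 2 := by
    intro t ht
    have ht1 : 20 * (rPlus M a + M) ≤ t := le_trans hA1 ht.1
    have ht0 : 0 < t := lt_of_lt_of_le hA0 ht.1
    have hrL : 8 * kgLamTilde M a m (lamf μa) ≤ M * kgOmega0 M a m ^ 2 * t := by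
      have e : 8 * Lmax ≤ M * w2 * A := by
        have := (div_le_iff₀ hMw).1 hA2
        linarith
      have : M * w2 * A ≤ M * w2 * t := mul_le_mul_of_nonneg_left ht.1 hMw.le
      rw [← hw2]; linarith
    have hup := kgQsharp_upper (m := m) h (lam := lamf μa) hw0 hμa1 ht1 hrL
    have e2 : 4 / 5 * (M * w2) / (2 * A) ≤ 4 / 5 * (M * kgOmega0 M a m ^ 2) / t := by
      rw [← hw2]
      exact div_le_div_of_nonneg_left (by positivity) ht0 ht.2
    have e3 : μa ^ 2 - w2 - 4 / 5 * (M * w2) / (2 * A) ≤ -(M * w2 / (5 * A)) := by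
      have : μa ^ 2 - w2 ≤ M * w2 / (5 * A) := hμa2
      have hq : 4 / 5 * (M * w2) / (2 * A) = 2 * (M * w2 / (5 * A)) := by field_simp; ring
      rw [hq]; linarith
    unfold famQ
    rw [hk2]
    linarith [hup, e2, e3]
  have hk10 : 10 < k ^ 2 * (2 * A - A) ^ 2 := by
    rw [hk2, show (2 * A - A) = A by ring]
    have e : 51 ≤ M * w2 * A := by
      have := (div_le_iff₀ hMw).1 hA3
      linarith
    have : M * w2 / (5 * A) * A ^ 2 = M * w2 * A / 5 := by field_simp
    rw [this]; linarith
  obtain ⟨z, hz, hz0⟩ := exists_zero_of_le_neg_sq (famQ_continuousOn (m := m) h lamf μa)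
    (fun t ht ↦ fam_hsol (m := m) h lamf μa ht) hAr (by linarith) hqk hk10
  exact ⟨z, lt_of_lt_of_le hAr hz.1, hz0⟩

/-! ### No zero at `μb` (non-negative potential: maximum principle from the horizon) -/

/-- `K(r₊) = 0` at threshold. [folklore] -/
theorem hzK_omega0_rPlus : hzK a m (kgOmega0 M a m : ℂ) (rPlus M a) = 0 := by
  have hM : M ≠ 0 := h.pos.ne'
  have hr : rPlus M a ≠ 0 := (lt_of_le_of_lt h.rMinus_nonneg h.rMinus_lt_rPlus).ne'
  have ham := a_mul_m_eq (m := m) hM hr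
  have hsq : rPlus M a ^ 2 + a ^ 2 = 2 * M * rPlus M a := by
    have h0 := delta_rPlus h.le
    unfold delta at h0
    linarith
  unfold hzK
  have key : kgOmega0 M a m * (rPlus M a ^ 2 + a ^ 2) - a * m = 0 := by rw [hsq, ham]; ring
  have hc := congrArg (fun x : ℝ ↦ (x : ℂ)) key
  push_cast at hc ⊢
  linear_combination hc

/-- **The horizon flux vanishes**: `Δ u'_{λ,μ} → 0` as `r ↓ r₊`. [cite: ShlapentokhRothman2014KleinGordon, §3.2] -/
theorem tendsto_flux_zero (lam μ : ℝ) :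
    Tendsto (fun s ↦ delta M a s * radRe' h m lam μ s) (𝓝[>] rPlus M a) (𝓝 0) := by
  have hc := hzC_pos h
  -- the continuous extension across the horizon
  set F : ℝ → ℝ := fun s ↦ (hzPhase M a m (kgOmega0 M a m) s *
      ((delta M a s : ℂ) * hzRhoC' M a m (kgOmega0 M a m) (lam : ℂ) μ (s : ℂ) -
        I * hzK a m (kgOmega0 M a m : ℂ) s * hzRhoC M a m (kgOmega0 M a m) (lam : ℂ) μ (s : ℂ)) / radCst M a m).re with hF
  have hFcont : ContinuousAt F (rPlus M a) := by
    have hP : ContinuousAt (hzPhase M a m (kgOmega0 M a m)) (rPlus M a) := continuousAt_hzPhase_omega0 (m := m) h h.rMinus_lt_rPlus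
    have habs : |((((lam, μ) : ℝ × ℝ), rPlus M a) : (ℝ × ℝ) × ℝ).2 - rPlus M a| < 2 * hzC M a / 5 := by
      simp only [sub_self, abs_zero]; positivity
    have hemb : ContinuousAt (fun s : ℝ ↦ ((((lam, μ) : ℝ × ℝ), s) : (ℝ × ℝ) × ℝ)) (rPlus M a) :=
      (continuous_const.prodMk continuous_id).continuousAt
    have hρ : ContinuousAt (fun s : ℝ ↦ hzRhoC M a m (kgOmega0 M a m) (lam : ℂ) μ (s : ℂ)) (rPlus M a) :=
      ContinuousAt.comp (f := fun s : ℝ ↦ ((((lam, μ) : ℝ × ℝ), s) : (ℝ × ℝ) × ℝ)) (continuousAt_hzRhoC_joint (m := m) h habs) hemb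
    have hρ' : ContinuousAt (fun s : ℝ ↦ hzRhoC' M a m (kgOmega0 M a m) (lam : ℂ) μ (s : ℂ)) (rPlus M a) :=
      ContinuousAt.comp (f := fun s : ℝ ↦ ((((lam, μ) : ℝ × ℝ), s) : (ℝ × ℝ) × ℝ)) (continuousAt_hzRhoC'_joint (m := m) h habs) hemb
    have hΔ : ContinuousAt (fun s : ℝ ↦ (delta M a s : ℂ)) (rPlus M a) := by
      have : Continuous fun s : ℝ ↦ (delta M a s : ℂ) := by unfold delta; fun_prop
      exact this.continuousAt
    have hK : ContinuousAt (fun s : ℝ ↦ hzK a m (kgOmega0 M a m : ℂ) s) (rPlus M a) := by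
      have : Continuous fun s : ℝ ↦ hzK a m (kgOmega0 M a m : ℂ) s := by unfold hzK; fun_prop
      exact this.continuousAt
    exact Complex.continuous_re.continuousAt.comp
      (((hP.mul ((hΔ.mul hρ').sub ((continuousAt_const.mul hK).mul hρ))).div_const _))
  have hF0 : F (rPlus M a) = 0 := by
    simp only [hF, delta_rPlus h.le, hzK_omega0_rPlus (m := m) h, Complex.ofReal_zero, zero_mul, mul_zero, sub_zero,
      zero_div, Complex.zero_re]
  have hlim : Tendsto F (𝓝[>] rPlus M a) (𝓝 0) := by
    have := hFcont.tendsto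
    rw [hF0] at this
    exact this.mono_left nhdsWithin_le_nhds
  -- agreement on `(r₊, r₊ + 2c/5)`
  have heq : ∀ᶠ s in 𝓝[>] rPlus M a, F s = delta M a s * radRe' h m lam μ s := by
    have hI : Ioo (rPlus M a) (rPlus M a + 2 * hzC M a / 5) ∈ 𝓝[>] rPlus M a := Ioo_mem_nhdsGT (by linarith)
    filter_upwards [hI] with s hs
    have hΔ0 : (delta M a s : ℂ) ≠ 0 := by exact_mod_cast (delta_pos_of_gt h hs.1).ne'
    rw [radRe', (radPair_eqOn (m := m) h lam μ).2 hs, hzRloc', hF]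
    rw [← Complex.re_ofReal_mul]
    field_simp
  exact hlim.congr' heq

/-- **Positivity at a non-negative potential**: if `V_μ(·; λ) ≥ 0` on `(r₊, ∞)` and
`u_{λ,μ} > 0` on an initial segment, then `u_{λ,μ} > 0` on `(r₊, ∞)`
(`HalfLineShooting.pos_of_flux_tendsto_zero`). [cite: ShlapentokhRothman2014KleinGordon, §3.2–3.3] -/
theorem radRe_pos_of_nonneg (lam μ : ℝ) (hV : ∀ t ∈ Ioi (rPlus M a), 0 ≤ kgVre M a m lam μ t) {r₁ : ℝ}
    (hr₁ : rPlus M a < r₁) (hinit : ∀ t ∈ Ioc (rPlus M a) r₁, 0 < radRe h m lam μ t) :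
    ∀ t ∈ Ioi (rPlus M a), 0 < radRe h m lam μ t :=
  pos_of_flux_tendsto_zero (P := delta M a) (G := fun t ↦ kgVre M a m lam μ t / delta M a t)
    (fun _ ht ↦ ⟨(radRe_hasDerivAt (m := m) h lam μ ht).1, radRe_flux_hasDerivAt (m := m) h lam μ ht⟩)
    (fun _ ht ↦ delta_pos_of_gt h ht) (fun t ht ↦ div_nonneg (hV t ht) (delta_pos_of_gt h ht).le)
    (tendsto_flux_zero (m := m) h lam μ) hr₁ hinit

/-! ### The real mode -/

/-- **A real mode at the superradiant threshold by shooting in the mass** (the ODE form of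
Shlapentokh-Rothman, CMP 329 (2014), §4.2, Props. 4.1–4.2, via
`HalfLineShooting.exists_boundState_of_sup_oscillation`). Let `λ : ℝ → ℝ` be continuous on
`[μa, μb]` (`0 < μa < μb`) with `0 ≤ λ̃(λ(μ)) ≤ Lmax` there, `ω₀ ≠ 0`, `ω₀² < μa²`,
`μb² ≤ (11/10)ω₀²`, `μa² − ω₀² ≤ Mω₀²/(5A(Lmax))`, and `V_{μb}(·; λ(μb)) ≥ 0` on `(r₊, ∞)`.
Then there is `μ₀ ∈ [μa, μb]` such that the horizon-regular solution `u_{λ(μ₀),μ₀}` of the radial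
ODE at `ω₀` is POSITIVE on `(r₊, ∞)` and its normal form `v = √Δ u` decays exponentially with
its derivative — a real mode solution with parameters `(ω₀, m, λ(μ₀), μ₀)`.
[cite: ShlapentokhRothman2014KleinGordon, §4.2 Prop. 4.2] -/
theorem exists_realMode (hw0 : kgOmega0 M a m ≠ 0) {μa μb Lmax : ℝ} (hab : μa < μb) (hμa0 : 0 < μa)
    (hcont : ContinuousOn lamf (Icc μa μb))
    (hL0 : ∀ μ ∈ Icc μa μb, 0 ≤ kgLamTilde M a m (lamf μ)) (hLmax : ∀ μ ∈ Icc μa μb, kgLamTilde M a m (lamf μ) ≤ Lmax)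
    (hγ : kgOmega0 M a m ^ 2 < μa ^ 2) (hμb : μb ^ 2 ≤ 11 / 10 * kgOmega0 M a m ^ 2)
    (hsmall : μa ^ 2 - kgOmega0 M a m ^ 2 ≤ M * kgOmega0 M a m ^ 2 / (5 * kgWindowA M a m Lmax))
    (hVb : ∀ t ∈ Ioi (rPlus M a), 0 ≤ kgVre M a m (lamf μb) μb t) :
    ∃ μ₀ ∈ Icc μa μb, (∀ t ∈ Ioi (rPlus M a), 0 < radRe h m (lamf μ₀) μ₀ t) ∧
      (∀ t ∈ Ici (kgTailS M a m μa), radV' h m (lamf μ₀) μ₀ t ≤ 0) ∧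
      ∃ C : ℝ, ∀ t : ℝ, kgTailS M a m μa + 1 ≤ t →
        |radV h m (lamf μ₀) μ₀ t| ≤ C * Real.exp (-(Real.sqrt ((μa ^ 2 - kgOmega0 M a m ^ 2) / 2) * t)) ∧
          |radV' h m (lamf μ₀) μ₀ t| ≤ C * Real.exp (-(Real.sqrt ((μa ^ 2 - kgOmega0 M a m ^ 2) / 2) * t)) := by
  have hM := h.pos
  have hrp : 0 ≤ rPlus M a := le_trans h.rMinus_nonneg h.rMinus_lt_rPlus.le
  have hμaI : μa ∈ Icc μa μb := ⟨le_rfl, hab.le⟩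
  have hμbI : μb ∈ Icc μa μb := ⟨hab.le, le_rfl⟩
  -- uniform initial positivity on the compact parameter image
  set K : Set (ℝ × ℝ) := (fun μ ↦ (lamf μ, μ)) '' Icc μa μb with hK
  have hKc : IsCompact K := isCompact_Icc.image_of_continuousOn (hcont.prodMk continuousOn_id)
  obtain ⟨δ, hδ, hδc, hposK⟩ := exists_uniform_pos (m := m) h hKc
  have hpos : ∀ μ ∈ Icc μa μb, ∀ t ∈ Ioc (rPlus M a) (rPlus M a + δ), 0 < famV h m lamf μ t := by
    intro μ hμ t ht
    have hq : ((lamf μ, μ) : ℝ × ℝ) ∈ K := ⟨μ, hμ, rfl⟩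
    have hu : 1 / 2 < radRe h m (lamf μ) μ t := hposK _ hq t ht
    have hs : 0 < Real.sqrt (delta M a t) := Real.sqrt_pos.2 (delta_pos_of_gt h ht.1)
    unfold famV radV
    exact mul_pos hs (by linarith)
  -- the hypotheses of the abstract shooting theorem
  have hjoint := fam_joint (m := m) h lamf hcont
  have hS : rPlus M a < kgTailS M a m μa := by
    have : 20 * (rPlus M a + M) ≤ kgTailS M a m μa := le_trans (le_max_left _ _) (le_max_left _ _)
    nlinarith
  have hc0 : 0 < (μa ^ 2 - kgOmega0 M a m ^ 2) / 2 := by linarith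
  have hZ : ∃ μ ∈ Icc μa μb, ∃ t ∈ Ioi (rPlus M a), famV h m lamf μ t = 0 := by
    have hμa1 : μa ^ 2 ≤ 11 / 10 * kgOmega0 M a m ^ 2 := by nlinarith
    obtain ⟨t, ht, h0⟩ := fam_zero_at_mua (m := m) h lamf hw0 (hLmax μa hμaI) hμa1 hsmall
    exact ⟨μa, hμaI, t, ht, h0⟩
  have hb : ∀ t ∈ Ioi (rPlus M a), famV h m lamf μb t ≠ 0 := by
    intro t ht
    have hinit : ∀ s ∈ Ioc (rPlus M a) (rPlus M a + δ), 0 < radRe h m (lamf μb) μb s := fun s hs ↦ by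
      have h12 := hposK ((lamf μb, μb)) ⟨μb, hμbI, rfl⟩ s hs
      linarith
    have hu := radRe_pos_of_nonneg (m := m) h (lamf μb) μb hVb (by linarith) hinit t ht
    have hs : 0 < Real.sqrt (delta M a t) := Real.sqrt_pos.2 (delta_pos_of_gt h ht)
    unfold famV radV
    exact (mul_pos hs hu).ne'
  obtain ⟨μ₀, hμ₀, hposv, hder, C, hdec⟩ := exists_boundState_of_sup_oscillation
    (Q := famQ M a m lamf) (v := famV h m lamf) (v' := famV' h m lamf) (r₀ := rPlus M a)
    (fun μ _ ↦ famQ_continuousOn (m := m) h lamf μ) (fun μ _ t ht ↦ fam_hsol (m := m) h lamf μ ht)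
    hjoint.1 hjoint.2 (by linarith : rPlus M a < rPlus M a + δ) hpos hS hc0
    (famQ_tail (m := m) h lamf hμa0 hγ hL0) hZ hb
  refine ⟨μ₀, hμ₀, fun t ht ↦ ?_, hder, C, hdec⟩
  have hv := hposv t ht
  have hs : 0 < Real.sqrt (delta M a t) := Real.sqrt_pos.2 (delta_pos_of_gt h ht)
  unfold famV radV at hv
  exact (mul_pos_iff_of_pos_left hs).1 hv

end Family

end Literature.Barriers.FinalStateConjecture

end
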